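import Mathlib
import HarnessLib
import HarnessLib.Audit
import Summits.ValiantsHypothesis.ValiantsHypothesis.Theorems.LacunarySymmetroidMatrixDescartesMiddleBinomial
import Summits.ValiantsHypothesis.ValiantsHypothesis.Theorems.LacunarySymmetroidMatrixDescartesDipWindow

/-!
# ValiantsHypothesis / LacunarySymmetroid — crux `MatrixDescartes` (stmt-ValiantsHypothesis-18050, V1), LINE (A) «product_plus_one»:
# the TOP-BINOMIAL cell `TopBinomialBlockAtMostTwo` (pen val-idea-25 g9 NOTE §56.11 THEOREM; Sketch-T3-s59 rev 11, typed there, «exact, proved on paper»)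

One W row `g = −α + κX^a + γX^c` (`α, γ > 0 ≤ κ`) times ANY number `k` of TOP-binomial zero-change rows `P_i = p_i + s_iX^c`
(`p_i, s_i > 0`) has AT MOST TWO positive critical points — `topBinomialBlockAtMostTwo` below is the pen's typed statement
VERBATIM (Descartes allows `2k` here; the companion cells `middleBinomialBlockAtMostOne`, `binomialLeadAtMostOne`,
`monomialRowAtMostOne` are already tree theorems).  This is the company «one `(+,−,−)`-type row (up to sign) with `k` one-signed
rows» of the floor `OneChangeFloorK3` at the bottom coupling, in the sub-class where the one-signed rows are top binomials.

PROOF (the pen's multiplier quotient, made derivative-light).  With the Euler operator `θ = t·d/dt`, `B = ∏ P_i`,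
`σ_i = s_it^c/P_i ∈ (0,1)`, `S₁ = Σσ_i`, `S₂ = Σσ_i²`, `G = θg = aκt^a + cγt^c > 0`, `G₂ = θG`:
* `t·Φ′ = B·(G + c·g·S₁)` (`Φ = g·B`), so the positive critical points are the zeros of `F̂ := (1 + c·g·S₁/G)/B`, and at each of them `g < 0 < S₁`;
* `F̂′ = (c·g·S₁/(t·B·G))·J` with `J = c(1 − S₁ − S₂/S₁) − G₂/G` (`hasDerivAt_Fhat`);
* `J` is STRICTLY DECREASING on `(0,∞)`: `G₂/G` is a weighted mean of `a < c` whose weight moves to `c` (`ratio_mono`), and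
  `S₁ + S₂/S₁` increases strictly because every `σ_i` does — by the finite-difference identity
  `(T₁²+T₂)S₁ − (S₁²+S₂)T₁ = Δ₁(S₁²−S₂) + S₁Δ₁² + 2S₁Σσ_iΔ_i + S₁ΣΔ_i²` (`sum_add_sqDiv_lt`);
* Rolle: between two critical points `F̂′` vanishes, i.e. `J` vanishes (there `g < 0`); three critical points would give two zeros of the
  injective `J`.

HONEST FRAMING: exact free-standing helper (one more cell of the «one W row × zero-change block» family); NOT T3♯ / T3♮ / the floor law;
no stub of LINE (A) is touched (A40 unchanged, sorries 4 → 4); `OneChangeFloorK3`, `MatrixDescartes` OPEN; `VP ≠ VNP` is NOT proved and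
nothing here bears on it.  No definitions, no named facts, no sorry.
-/

set_option linter.dupNamespace false

namespace Summit.ValiantsHypothesis.ValiantsHypothesis.Theorems.LacunarySymmetroidMatrixDescartes

namespace ZeroChange

open Polynomial Finset Set

/-- **Monotonicity of `S₁ + S₂/S₁`** under a coordinatewise increase `0 < σ_j < τ_j` (nonempty index type):
`Σσ + Σσ²/Σσ < Στ + Στ²/Στ`.  Finite-difference identity: with `Δ = τ − σ`,
`(T₁²+T₂)S₁ − (S₁²+S₂)T₁ = Δ₁(S₁²−S₂) + S₁Δ₁² + 2S₁ΣσΔ + S₁ΣΔ² > 0`. -/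
theorem sum_add_sqDiv_lt {k : ℕ} (σ τ : Fin k → ℝ) (hσ : ∀ j, 0 < σ j) (hlt : ∀ j, σ j < τ j) (j₀ : Fin k) :
    (∑ j, σ j) + (∑ j, σ j ^ 2) / (∑ j, σ j) < (∑ j, τ j) + (∑ j, τ j ^ 2) / (∑ j, τ j) := by
  have hS₁ : 0 < ∑ j, σ j := sum_pos (fun j _ => hσ j) ⟨j₀, mem_univ _⟩
  have hT₁ : 0 < ∑ j, τ j := sum_pos (fun j _ => (hσ j).trans (hlt j)) ⟨j₀, mem_univ _⟩
  have hΔ₁ : 0 < ∑ j, (τ j - σ j) := sum_pos (fun j _ => sub_pos.2 (hlt j)) ⟨j₀, mem_univ _⟩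
  have hM : 0 ≤ ∑ j, σ j * (τ j - σ j) := sum_nonneg fun j _ => mul_nonneg (hσ j).le (sub_pos.2 (hlt j)).le
  have hΔ₂ : 0 ≤ ∑ j, (τ j - σ j) ^ 2 := sum_nonneg fun j _ => sq_nonneg _
  have hS₂ : ∑ j, σ j ^ 2 ≤ (∑ j, σ j) ^ 2 := sum_sq_le_sq_sum_of_nonneg fun j _ => (hσ j).le
  have eT₁ : ∑ j, τ j = ∑ j, σ j + ∑ j, (τ j - σ j) := by
    rw [← sum_add_distrib]; exact sum_congr rfl fun j _ => by ring
  have eT₂ : ∑ j, τ j ^ 2 = ∑ j, σ j ^ 2 + 2 * ∑ j, σ j * (τ j - σ j) + ∑ j, (τ j - σ j) ^ 2 := by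
    rw [mul_sum, ← sum_add_distrib, ← sum_add_distrib]; exact sum_congr rfl fun j _ => by ring
  have e1 : (∑ j, σ j) + (∑ j, σ j ^ 2) / (∑ j, σ j) = ((∑ j, σ j) ^ 2 + ∑ j, σ j ^ 2) / (∑ j, σ j) := by
    rw [eq_div_iff hS₁.ne']; field_simp
  have e2 : (∑ j, τ j) + (∑ j, τ j ^ 2) / (∑ j, τ j) = ((∑ j, τ j) ^ 2 + ∑ j, τ j ^ 2) / (∑ j, τ j) := by
    rw [eq_div_iff hT₁.ne']; field_simp
  rw [e1, e2, div_lt_div_iff₀ hS₁ hT₁, eT₁, eT₂]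
  nlinarith [mul_nonneg hΔ₁.le (sub_nonneg.2 hS₂), mul_pos hS₁ (pow_pos hΔ₁ 2), mul_nonneg hS₁.le hM,
    mul_nonneg hS₁.le hΔ₂]

/-- **The rate `θ²g/θg` of the W row is non-decreasing**: for `0 < t ≤ t'`, `0 < a < c`, `κ ≥ 0 < γ`,
`(a²κt^a + c²γt^c)/(aκt^a + cγt^c) ≤ (a²κt'^a + c²γt'^c)/(aκt'^a + cγt'^c)` (a weighted mean of `a` and `c` whose weight drifts to `c`). -/
theorem ratio_mono {a c : ℕ} (ha : 0 < a) (hac : a < c) {κ γ : ℝ} (hκ : 0 ≤ κ) (hγ : 0 < γ) {t t' : ℝ} (ht : 0 < t)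
    (htt : t ≤ t') :
    ((a : ℝ) ^ 2 * κ * t ^ a + (c : ℝ) ^ 2 * γ * t ^ c) / ((a : ℝ) * κ * t ^ a + (c : ℝ) * γ * t ^ c) ≤
      ((a : ℝ) ^ 2 * κ * t' ^ a + (c : ℝ) ^ 2 * γ * t' ^ c) / ((a : ℝ) * κ * t' ^ a + (c : ℝ) * γ * t' ^ c) := by
  have ht' : 0 < t' := ht.trans_le htt
  have ha' : (0 : ℝ) < a := by exact_mod_cast ha
  have hc' : (0 : ℝ) < c := by exact_mod_cast (ha.trans hac)
  have hca : (0 : ℝ) ≤ (c : ℝ) - a := by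
    have : (a : ℝ) ≤ c := by exact_mod_cast hac.le
    linarith
  have hden : ∀ u : ℝ, 0 < u → 0 < (a : ℝ) * κ * u ^ a + (c : ℝ) * γ * u ^ c := fun u hu =>
    add_pos_of_nonneg_of_pos (by positivity) (by positivity)
  obtain ⟨d, hd⟩ : ∃ d, c = a + d := ⟨c - a, by omega⟩
  have key : t ^ c * t' ^ a ≤ t ^ a * t' ^ c := by
    rw [hd, pow_add, pow_add]
    have h1 : t ^ d ≤ t' ^ d := pow_le_pow_left₀ ht.le htt d
    have h2 : 0 ≤ t ^ a * t' ^ a := by positivity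
    nlinarith [mul_le_mul_of_nonneg_left h1 h2]
  rw [div_le_div_iff₀ (hden t ht) (hden t' ht')]
  have hcoef : 0 ≤ (a : ℝ) * c * κ * γ * ((c : ℝ) - a) := by positivity
  nlinarith [mul_le_mul_of_nonneg_left key hcoef]

/-- **TOP-BINOMIAL CELL (NOTE §56.11 THEOREM) — the pen g9 Sketch-T3-s59 `TopBinomialBlockAtMostTwo`, VERBATIM**: one W row
`(−α, κ, γ)` and any `k` top-binomial zero-change rows `p_i + s_iX^c` have at most TWO positive critical points. -/
theorem topBinomialBlockAtMostTwo : ∀ (k a c : ℕ), 0 < a → a < c → ∀ (α κ γ : ℝ) (p s : Fin k → ℝ),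
    0 < α → 0 ≤ κ → 0 < γ → (∀ i, 0 < p i ∧ 0 < s i) →
    posCrit (row a c (-α) κ γ * ∏ i, row a c (p i) 0 (s i)) ≤ 2 := by
  intro k a c ha hac α κ γ p s hα hκ hγ h
  classical
  have hc : 0 < c := ha.trans hac
  have ha' : (0 : ℝ) < a := by exact_mod_cast ha
  have hc' : (0 : ℝ) < c := by exact_mod_cast hc
  -- the polynomial objects
  set gW : ℝ[X] := row a c (-α) κ γ with hgW
  set B : ℝ[X] := ∏ i, row a c (p i) 0 (s i) with hB
  -- the real functions of the proof
  obtain ⟨P, hP⟩ : ∃ P : Fin k → ℝ → ℝ, ∀ i t, P i t = p i + s i * t ^ c := ⟨_, fun _ _ => rfl⟩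
  obtain ⟨σ, hσ⟩ : ∃ σ : Fin k → ℝ → ℝ, ∀ i t, σ i t = s i * t ^ c / P i t := ⟨_, fun _ _ => rfl⟩
  obtain ⟨S₁, hS₁⟩ : ∃ S₁ : ℝ → ℝ, ∀ t, S₁ t = ∑ i, σ i t := ⟨_, fun _ => rfl⟩
  obtain ⟨S₂, hS₂⟩ : ∃ S₂ : ℝ → ℝ, ∀ t, S₂ t = ∑ i, σ i t ^ 2 := ⟨_, fun _ => rfl⟩
  obtain ⟨g, hg⟩ : ∃ g : ℝ → ℝ, ∀ t, g t = -α + κ * t ^ a + γ * t ^ c := ⟨_, fun _ => rfl⟩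
  obtain ⟨G, hG⟩ : ∃ G : ℝ → ℝ, ∀ t, G t = (a : ℝ) * κ * t ^ a + (c : ℝ) * γ * t ^ c := ⟨_, fun _ => rfl⟩
  obtain ⟨G₂, hG₂⟩ : ∃ G₂ : ℝ → ℝ, ∀ t, G₂ t = (a : ℝ) ^ 2 * κ * t ^ a + (c : ℝ) ^ 2 * γ * t ^ c :=
    ⟨_, fun _ => rfl⟩
  obtain ⟨Bf, hBf⟩ : ∃ Bf : ℝ → ℝ, ∀ t, Bf t = ∏ i, P i t := ⟨_, fun _ => rfl⟩
  obtain ⟨J, hJ⟩ : ∃ J : ℝ → ℝ, ∀ t, J t = (c : ℝ) * (1 - S₁ t - S₂ t / S₁ t) - G₂ t / G t := ⟨_, fun _ => rfl⟩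
  obtain ⟨F, hF⟩ : ∃ F : ℝ → ℝ, ∀ t, F t = (1 + (c : ℝ) * g t * S₁ t / G t) / Bf t := ⟨_, fun _ => rfl⟩
  -- elementary facts
  have hPpos : ∀ i t, 0 < t → 0 < P i t := fun i t ht => by
    rw [hP]; nlinarith [(h i).1, mul_pos (h i).2 (pow_pos ht c)]
  have hProw : ∀ i t, (row a c (p i) 0 (s i)).eval t = P i t := fun i t => by simp [eval_row, hP]
  have hgrow : ∀ t, gW.eval t = g t := fun t => by simp [hgW, eval_row, hg]
  have hBev : ∀ t, B.eval t = Bf t := fun t => by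
    rw [hB, eval_prod, hBf]; exact prod_congr rfl fun i _ => hProw i t
  have hBpos : ∀ t, 0 < t → 0 < Bf t := fun t ht => by rw [hBf]; exact prod_pos fun i _ => hPpos i t ht
  have hGpos : ∀ t, 0 < t → 0 < G t := fun t ht => by
    rw [hG]; exact add_pos_of_nonneg_of_pos (by positivity) (by positivity)
  have hσpos : ∀ i t, 0 < t → 0 < σ i t := fun i t ht => by
    rw [hσ]; exact div_pos (mul_pos (h i).2 (pow_pos ht c)) (hPpos i t ht)
  have hσmono : ∀ i t t', 0 < t → t < t' → σ i t < σ i t' := fun i t t' ht htt => by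
    have ht' : 0 < t' := ht.trans htt
    have hpow : t ^ c < t' ^ c := pow_lt_pow_left₀ htt ht.le hc.ne'
    rw [hσ, hσ, div_lt_div_iff₀ (hPpos i t ht) (hPpos i t' ht'), hP, hP]
    nlinarith [(h i).1, (h i).2, mul_pos (h i).2 (mul_pos (h i).1 (sub_pos.2 hpow))]
  have hS₁nn : ∀ t, 0 < t → 0 ≤ S₁ t := fun t ht => by
    rw [hS₁]; exact sum_nonneg fun i _ => (hσpos i t ht).le
  have hgmono : ∀ t t', 0 ≤ t → t ≤ t' → g t ≤ g t' := fun t t' ht htt => by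
    rw [← hgrow, ← hgrow, hgW]; exact eval_row_mono _ hκ hγ.le ht htt
  -- `B′(t) = B(t)·c·S₁(t)/t` and `t·g′(t) = G(t)`
  have hBder : ∀ t, 0 < t → (derivative B).eval t = Bf t * ((c : ℝ) * S₁ t / t) := by
    intro t ht
    have hB' : (derivative B).eval t =
        B.eval t * ∑ i, (derivative (row a c (p i) 0 (s i))).eval t / (row a c (p i) 0 (s i)).eval t := by
      have := eval_derivative_prod_rows k a c (fun i => (p i, (0 : ℝ), s i)) (x := t)
        (fun j => by simpa [hProw] using (hPpos j t ht).ne')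
      simpa [hB] using this
    have hsum : t * ∑ i, (derivative (row a c (p i) 0 (s i))).eval t / (row a c (p i) 0 (s i)).eval t
        = (c : ℝ) * S₁ t := by
      rw [hS₁, mul_sum, mul_sum]
      refine sum_congr rfl fun i _ => ?_
      rw [mul_div_assoc', mul_eval_derivative_row, hProw, hσ]
      ring
    rw [hB', hBev, ← hsum, mul_div_cancel_left₀ _ ht.ne']
  have hgWder : ∀ t, t * (derivative gW).eval t = G t := fun t => by
    rw [hgW, mul_eval_derivative_row, hG]
  -- the link `t·Φ′(t) = B(t)·(G(t) + c·g(t)·S₁(t))`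
  have hlink : ∀ t, 0 < t →
      t * (derivative (gW * B)).eval t = Bf t * (G t + (c : ℝ) * g t * S₁ t) := by
    intro t ht
    rw [derivative_mul, eval_add, eval_mul, eval_mul, hBder t ht, hgrow, hBev]
    calc t * ((derivative gW).eval t * Bf t + g t * (Bf t * ((c : ℝ) * S₁ t / t)))
        = (t * (derivative gW).eval t) * Bf t + g t * Bf t * (c : ℝ) * S₁ t * (t / t) := by ring
      _ = Bf t * (G t + (c : ℝ) * g t * S₁ t) := by rw [hgWder, div_self ht.ne']; ring
  -- at a positive critical point: `G + c·g·S₁ = 0`, hence `g < 0 < S₁` and `F = 0`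
  have hcrit : ∀ t, 0 < t → (derivative (gW * B)).eval t = 0 →
      G t + (c : ℝ) * g t * S₁ t = 0 ∧ g t < 0 ∧ 0 < S₁ t ∧ F t = 0 := by
    intro t ht hD
    have h0 : G t + (c : ℝ) * g t * S₁ t = 0 := by
      have := hlink t ht
      rw [hD, mul_zero] at this
      rcases mul_eq_zero.1 this.symm with h1 | h1
      · exact absurd h1 (hBpos t ht).ne'
      · exact h1
    have hgS : g t * S₁ t < 0 := by nlinarith [hGpos t ht]
    have hS : 0 < S₁ t := by
      rcases (hS₁nn t ht).eq_or_lt with h1 | h1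
      · rw [← h1, mul_zero] at hgS; exact absurd hgS (lt_irrefl _)
      · exact h1
    have hgt : g t < 0 := by
      rcases lt_or_ge (g t) 0 with h1 | h1
      · exact h1
      · nlinarith [mul_nonneg h1 hS.le]
    refine ⟨h0, hgt, hS, ?_⟩
    have e : (c : ℝ) * g t * S₁ t = -G t := by linarith
    rw [hF, e, neg_div, div_self (hGpos t ht).ne', add_neg_cancel, zero_div]
  -- the derivative of `F` on `(0,∞)` (when there is at least one top row)
  have hFd : ∀ j₀ : Fin k, ∀ t, 0 < t →
      HasDerivAt F ((c : ℝ) * g t * S₁ t / (t * Bf t * G t) * J t) t := by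
    intro j₀ t ht
    have ht0 : t ≠ 0 := ht.ne'
    have hS₁pos : 0 < S₁ t := by
      rw [hS₁]; exact sum_pos (fun i _ => hσpos i t ht) ⟨j₀, mem_univ _⟩
    have hpowa : (a : ℝ) * t ^ (a - 1) = (a : ℝ) * t ^ a / t := by
      rw [eq_div_iff ht0, mul_assoc, ← pow_succ, Nat.sub_add_cancel (show 1 ≤ a from ha)]
    have hpowc : (c : ℝ) * t ^ (c - 1) = (c : ℝ) * t ^ c / t := by
      rw [eq_div_iff ht0, mul_assoc, ← pow_succ, Nat.sub_add_cancel (show 1 ≤ c from hc)]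
    -- rows
    have hPd : ∀ i, HasDerivAt (P i) (s i * ((c : ℝ) * t ^ c / t)) t := by
      intro i
      have h1 : HasDerivAt (fun x => p i + s i * x ^ c) (s i * ((c : ℝ) * t ^ (c - 1))) t :=
        ((hasDerivAt_pow c t).const_mul (s i)).const_add (p i)
      rw [hpowc] at h1
      exact h1.congr_of_eventuallyEq (Filter.Eventually.of_forall (hP i))
    have hσd : ∀ i, HasDerivAt (σ i) ((c : ℝ) * σ i t * (1 - σ i t) / t) t := by
      intro i
      have h1 := ((hasDerivAt_pow c t).const_mul (s i)).fun_div (hPd i) (hPpos i t ht).ne'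
      rw [hpowc] at h1
      refine (h1.congr_of_eventuallyEq (Filter.Eventually.of_forall (hσ i))).congr_deriv ?_
      have hP0 : P i t ≠ 0 := (hPpos i t ht).ne'
      rw [hσ]
      field_simp
    have hS₁d : HasDerivAt S₁ ((c : ℝ) * (S₁ t - S₂ t) / t) t := by
      have h1 : HasDerivAt (fun x => ∑ i, σ i x) (∑ i, (c : ℝ) * σ i t * (1 - σ i t) / t) t :=
        HasDerivAt.fun_sum (u := univ) (fun i _ => hσd i)
      refine (h1.congr_of_eventuallyEq (Filter.Eventually.of_forall hS₁)).congr_deriv ?_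
      rw [hS₁, hS₂, ← sum_sub_distrib, mul_sum, sum_div]
      exact sum_congr rfl fun i _ => by ring
    have hgd : HasDerivAt g (G t / t) t := by
      have h1 : HasDerivAt (fun x => -α + κ * x ^ a + γ * x ^ c)
          (κ * ((a : ℝ) * t ^ (a - 1)) + γ * ((c : ℝ) * t ^ (c - 1))) t :=
        (((hasDerivAt_pow a t).const_mul κ).const_add (-α)).fun_add ((hasDerivAt_pow c t).const_mul γ)
      refine (h1.congr_of_eventuallyEq (Filter.Eventually.of_forall hg)).congr_deriv ?_
      rw [hG]
      have e1 : κ * ((a : ℝ) * t ^ (a - 1)) = (a : ℝ) * κ * t ^ a / t := by rw [hpowa]; ring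
      have e2 : γ * ((c : ℝ) * t ^ (c - 1)) = (c : ℝ) * γ * t ^ c / t := by rw [hpowc]; ring
      rw [e1, e2]; ring
    have hGd : HasDerivAt G (G₂ t / t) t := by
      have h1 : HasDerivAt (fun x => (a : ℝ) * κ * x ^ a + (c : ℝ) * γ * x ^ c)
          ((a : ℝ) * κ * ((a : ℝ) * t ^ (a - 1)) + (c : ℝ) * γ * ((c : ℝ) * t ^ (c - 1))) t :=
        ((hasDerivAt_pow a t).const_mul ((a : ℝ) * κ)).fun_add ((hasDerivAt_pow c t).const_mul ((c : ℝ) * γ))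
      refine (h1.congr_of_eventuallyEq (Filter.Eventually.of_forall hG)).congr_deriv ?_
      rw [hG₂]
      have e1 : (a : ℝ) * κ * ((a : ℝ) * t ^ (a - 1)) = (a : ℝ) ^ 2 * κ * t ^ a / t := by rw [hpowa]; ring
      have e2 : (c : ℝ) * γ * ((c : ℝ) * t ^ (c - 1)) = (c : ℝ) ^ 2 * γ * t ^ c / t := by rw [hpowc]; ring
      rw [e1, e2]; ring
    have hBfd : HasDerivAt Bf (Bf t * ((c : ℝ) * S₁ t / t)) t :=
      ((B.hasDerivAt t).congr_of_eventuallyEq (Filter.Eventually.of_forall fun x => (hBev x).symm)).congr_deriv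
        (hBder t ht)
    -- assemble
    have h1 := ((hgd.const_mul (c : ℝ)).fun_mul hS₁d).fun_div hGd (hGpos t ht).ne'
    have h2 := (h1.const_add 1).fun_div hBfd (hBpos t ht).ne'
    refine (h2.congr_of_eventuallyEq (Filter.Eventually.of_forall hF)).congr_deriv ?_
    have hB0 : Bf t ≠ 0 := (hBpos t ht).ne'
    have hG0 : G t ≠ 0 := (hGpos t ht).ne'
    have hS0 : S₁ t ≠ 0 := hS₁pos.ne'
    rw [hJ]
    field_simp
    ring
  -- `J` is strictly decreasing on `(0,∞)`
  have hJanti : ∀ j₀ : Fin k, ∀ t t', 0 < t → t < t' → J t' < J t := by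
    intro j₀ t t' ht htt
    have h1 := sum_add_sqDiv_lt (fun i => σ i t) (fun i => σ i t') (fun i => hσpos i t ht)
      (fun i => hσmono i t t' ht htt) j₀
    have h2 := ratio_mono ha hac hκ hγ ht htt.le
    rw [← hS₁, ← hS₁, ← hS₂, ← hS₂] at h1
    rw [← hG, ← hG, ← hG₂, ← hG₂] at h2
    rw [hJ, hJ]
    nlinarith [mul_lt_mul_of_pos_left h1 hc']
  -- Rolle: between two positive critical points, `J` vanishes
  have hRolle : ∀ j₀ : Fin k, ∀ u v, 0 < u → u < v → (derivative (gW * B)).eval u = 0 →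
      (derivative (gW * B)).eval v = 0 → ∃ ξ, u < ξ ∧ ξ < v ∧ J ξ = 0 := by
    intro j₀ u v hu huv hDu hDv
    obtain ⟨-, -, -, hFu⟩ := hcrit u hu hDu
    obtain ⟨-, hgv, -, hFv⟩ := hcrit v (hu.trans huv) hDv
    have hcont : ContinuousOn F (Icc u v) := fun w hw =>
      (hFd j₀ w (hu.trans_le hw.1)).continuousAt.continuousWithinAt
    obtain ⟨ξ, hξ, hξ0⟩ := exists_hasDerivAt_eq_zero huv hcont (hFu.trans hFv.symm)
      (fun w hw => hFd j₀ w (hu.trans hw.1))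
    have hξpos : 0 < ξ := hu.trans hξ.1
    have hgξ : g ξ < 0 := (hgmono ξ v hξpos.le hξ.2.le).trans_lt hgv
    have hS₁ξ : 0 < S₁ ξ := by
      rw [hS₁]; exact sum_pos (fun i _ => hσpos i ξ hξpos) ⟨j₀, mem_univ _⟩
    refine ⟨ξ, hξ.1, hξ.2, ?_⟩
    have hne : (c : ℝ) * g ξ * S₁ ξ / (ξ * Bf ξ * G ξ) ≠ 0 := by
      apply div_ne_zero
      · exact mul_ne_zero (mul_ne_zero hc'.ne' hgξ.ne) hS₁ξ.ne'
      · exact mul_ne_zero (mul_ne_zero hξpos.ne' (hBpos ξ hξpos).ne') (hGpos ξ hξpos).ne'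
    rcases mul_eq_zero.1 hξ0 with h1 | h1
    · exact absurd h1 hne
    · exact h1
  -- three positive critical points are impossible
  have hmain : ∀ t₁ t₂ t₃, 0 < t₁ → t₁ < t₂ → t₂ < t₃ → (derivative (gW * B)).eval t₁ = 0 →
      (derivative (gW * B)).eval t₂ = 0 → (derivative (gW * B)).eval t₃ = 0 → False := by
    intro t₁ t₂ t₃ h1 h12 h23 hD1 hD2 hD3
    -- there is at least one top row (else `S₁ = 0`, contradicting `0 < S₁ t₁`)
    obtain ⟨-, -, hSpos, -⟩ := hcrit t₁ h1 hD1
    have hk : Nonempty (Fin k) := by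
      rcases isEmpty_or_nonempty (Fin k) with hk | hk
      · rw [hS₁] at hSpos
        simp at hSpos
      · exact hk
    obtain ⟨j₀⟩ := hk
    obtain ⟨ξ₁, hξ₁, hξ₁', hJ₁⟩ := hRolle j₀ t₁ t₂ h1 h12 hD1 hD2
    obtain ⟨ξ₂, hξ₂, hξ₂', hJ₂⟩ := hRolle j₀ t₂ t₃ (h1.trans h12) h23 hD2 hD3
    have := hJanti j₀ ξ₁ ξ₂ (h1.trans hξ₁) (hξ₁'.trans hξ₂)
    rw [hJ₁, hJ₂] at this
    exact lt_irrefl _ this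
  -- count
  rw [posCrit]
  by_contra hcard
  rw [not_le] at hcard
  obtain ⟨x, hx, y, hy, z, hz, hxy, hxz, hyz⟩ := Finset.two_lt_card.1 hcard
  simp only [Finset.mem_filter, Multiset.mem_toFinset, mem_roots', IsRoot.def] at hx hy hz
  obtain ⟨⟨-, hDx⟩, hx0⟩ := hx
  obtain ⟨⟨-, hDy⟩, hy0⟩ := hy
  obtain ⟨⟨-, hDz⟩, hz0⟩ := hz
  rcases lt_or_gt_of_ne hxy with hxy | hxy <;> rcases lt_or_gt_of_ne hyz with hyz | hyz <;>
    rcases lt_or_gt_of_ne hxz with hxz | hxz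
  · exact hmain x y z hx0 hxy hyz hDx hDy hDz
  · exact absurd (hxy.trans hyz) (lt_asymm hxz)
  · exact hmain x z y hx0 hxz hyz hDx hDz hDy
  · exact hmain z x y hz0 hxz hxy hDz hDx hDy
  · exact hmain y x z hy0 hxy hxz hDy hDx hDz
  · exact hmain y z x hy0 hyz hxz hDy hDz hDx
  · exact absurd (hxz.trans hyz) (lt_asymm hxy)
  · exact hmain z y x hz0 hyz hxy hDz hDy hDx

end ZeroChange

end Summit.ValiantsHypothesis.ValiantsHypothesis.Theorems.LacunarySymmetroidMatrixDescartes
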